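import Literature.AlgebraicTopology.SingularHomology.LerayHirschMaps
import HarnessLib

/-!
# The Leray–Hirsch comparison maps: the pair step (five lemma)

D. Husemoller, *Fibre Bundles* (3rd ed. 1994), Ch. 17 §1, proof of Thm. 1.1: the comparison
`θ_U : K(U) = ⊕ⱼ H*⁻ᵈʲ(U) → L(U) = H*(p⁻¹U)` "commutes with the coboundary operators" and "by the
five lemma" its isomorphy propagates. Here the propagation is along the long exact sequence of a
PAIR (Hatcher 2002, §3.1 pp. 199–200; the variant of Husemoller's Mayer–Vietoris argument used in
Hatcher's proof of Thm. 4D.1, p. 433): for a map `q : E' → B'`, classes `cⱼ ∈ Hᵈʲ(E')` and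
`A ⊆ B'`, the ladder

  `Π Hᵏ⁻ᵈʲ(B') → Π Hᵏ⁻ᵈʲ(A) → Π Hᵏ⁺¹⁻ᵈʲ(B', A) → Π Hᵏ⁺¹⁻ᵈʲ(B') → Π Hᵏ⁺¹⁻ᵈʲ(A)`
  `   ↓θ            ↓θ             ↓θ_rel               ↓θ              ↓θ`
  `Hᵏ(E')     →  Hᵏ(q⁻¹A)   →  Hᵏ⁺¹(E', q⁻¹A)   →   Hᵏ⁺¹(E')    →   Hᵏ⁺¹(q⁻¹A)`

commutes (`LerayHirschMaps`: `map_lhMap`, `δ_lhMap`, `toAbsolute_lhRel`) and has exact rows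
(componentwise long exact sequences of the pairs; in the top row the components with
`d j = k + 1`, which have no degree-`(-1)` predecessor, are handled by the injectivity of
`H⁰(B', A) → H⁰(B')`). Consequences (`LinearMap.bijective_of_five_lemma`):

* `bijective_lhRel_of_abs`: `θ` bijective for `E' → B'` and for `q⁻¹A → A` (all degrees) ⇒ the
  relative `θ_rel` of the pair is bijective (all degrees);
* `bijective_lhMap_of_rel`: `θ_rel` bijective and `θ` bijective for `q⁻¹A → A` ⇒ `θ` bijective for
  `E' → B'`.

Everything is proved; no named facts.

## References

* D. Husemoller, *Fibre Bundles*, GTM 20, Springer 1994, Ch. 17 §1 Thm. 1.1 (proof). [HusemollerFibreBundles1994]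
* A. Hatcher, *Algebraic Topology*, CUP 2002, §4.D Thm. 4D.1 (proof), §3.1 pp. 199–200, §2.1 p. 129. [HatcherAT2002]
-/

noncomputable section

open CategoryTheory Function Set

universe u w

/-! ### Degenerate five lemmas (rows starting with zero) -/

section FiveLemma

variable {R : Type*} [CommRing R]
  {A₂ A₃ A₄ A₅ B₂ B₃ B₄ B₅ : Type*}
  [AddCommGroup A₂] [AddCommGroup A₃] [AddCommGroup A₄] [AddCommGroup A₅]
  [AddCommGroup B₂] [AddCommGroup B₃] [AddCommGroup B₄] [AddCommGroup B₅]
  [Module R A₂] [Module R A₃] [Module R A₄] [Module R A₅]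
  [Module R B₂] [Module R B₃] [Module R B₄] [Module R B₅]

/-- The five lemma for rows `0 → A₂ → A₃ → A₄ → A₅`, `0 → B₂ → B₃ → B₄ → B₅` (`g₂` injective).
[cite: HatcherAT2002, §2.1 p. 129 (five lemma)] -/
theorem LinearMap.bijective_of_five_lemma_zero₁
    (f₂ : A₂ →ₗ[R] A₃) (f₃ : A₃ →ₗ[R] A₄) (f₄ : A₄ →ₗ[R] A₅)
    (g₂ : B₂ →ₗ[R] B₃) (g₃ : B₃ →ₗ[R] B₄) (g₄ : B₄ →ₗ[R] B₅)
    (v₂ : A₂ →ₗ[R] B₂) (v₃ : A₃ →ₗ[R] B₃) (v₄ : A₄ →ₗ[R] B₄) (v₅ : A₅ →ₗ[R] B₅)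
    (sq₂ : ∀ x, v₃ (f₂ x) = g₂ (v₂ x)) (sq₃ : ∀ x, v₄ (f₃ x) = g₃ (v₃ x)) (sq₄ : ∀ x, v₅ (f₄ x) = g₄ (v₄ x))
    (exA₃ : ∀ x, f₃ x = 0 → ∃ y, f₂ y = x) (exA₄ : ∀ x, f₄ x = 0 → ∃ y, f₃ y = x)
    (hg₂ : Injective g₂) (exB₃ : ∀ x, g₃ x = 0 → ∃ y, g₂ y = x) (hB₃₄ : ∀ x, g₄ (g₃ x) = 0)
    (h₂ : Bijective v₂) (h₄ : Bijective v₄) (h₅ : Injective v₅) :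
    Bijective v₃ :=
  LinearMap.bijective_of_five_lemma (0 : PUnit.{1} →ₗ[R] A₂) f₂ f₃ f₄ (0 : PUnit.{1} →ₗ[R] B₂) g₂ g₃ g₄
    (0 : PUnit.{1} →ₗ[R] PUnit.{1}) v₂ v₃ v₄ v₅
    (fun _ ↦ by simp only [LinearMap.zero_apply, map_zero]) sq₂ sq₃ sq₄
    (fun _ ↦ by rw [LinearMap.zero_apply, map_zero]) exA₃ exA₄
    (fun x hx ↦ ⟨PUnit.unit, by rw [LinearMap.zero_apply]; exact (hg₂ (hx.trans (map_zero g₂).symm)).symm⟩) exB₃ hB₃₄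
    (fun x ↦ ⟨x, Subsingleton.elim _ _⟩) h₂ h₄ h₅

/-- The five lemma for rows `0 → 0 → A₃ → A₄ → A₅`, `0 → 0 → B₃ → B₄ → B₅` (`f₃`, `g₃` injective).
[cite: HatcherAT2002, §2.1 p. 129 (five lemma)] -/
theorem LinearMap.bijective_of_five_lemma_zero₁₂
    (f₃ : A₃ →ₗ[R] A₄) (f₄ : A₄ →ₗ[R] A₅) (g₃ : B₃ →ₗ[R] B₄) (g₄ : B₄ →ₗ[R] B₅)
    (v₃ : A₃ →ₗ[R] B₃) (v₄ : A₄ →ₗ[R] B₄) (v₅ : A₅ →ₗ[R] B₅)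
    (sq₃ : ∀ x, v₄ (f₃ x) = g₃ (v₃ x)) (sq₄ : ∀ x, v₅ (f₄ x) = g₄ (v₄ x))
    (hf₃ : Injective f₃) (exA₄ : ∀ x, f₄ x = 0 → ∃ y, f₃ y = x)
    (hg₃ : Injective g₃) (hB₃₄ : ∀ x, g₄ (g₃ x) = 0)
    (h₄ : Bijective v₄) (h₅ : Injective v₅) :
    Bijective v₃ :=
  LinearMap.bijective_of_five_lemma_zero₁ (0 : PUnit.{1} →ₗ[R] A₃) f₃ f₄ (0 : PUnit.{1} →ₗ[R] B₃) g₃ g₄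
    (0 : PUnit.{1} →ₗ[R] PUnit.{1}) v₃ v₄ v₅
    (fun _ ↦ by simp only [LinearMap.zero_apply, map_zero]) sq₃ sq₄
    (fun x hx ↦ ⟨PUnit.unit, by rw [LinearMap.zero_apply]; exact (hf₃ (hx.trans (map_zero f₃).symm)).symm⟩) exA₄
    (fun x y _ ↦ Subsingleton.elim x y)
    (fun x hx ↦ ⟨PUnit.unit, by rw [LinearMap.zero_apply]; exact (hg₃ (hx.trans (map_zero g₃).symm)).symm⟩) hB₃₄
    ⟨fun x y _ ↦ Subsingleton.elim x y, fun x ↦ ⟨x, Subsingleton.elim _ _⟩⟩ h₄ h₅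

end FiveLemma

namespace Literature.AlgebraicTopology.SingularHomology

namespace relSingularCohomology

variable {R : Type u} [CommRing R] {M : Type u} [AddCommGroup M] [Module R M] {X : Type u} [TopologicalSpace X]

/-- `δ ≫ (Hʲ(X, A) → Hʲ(X)) = 0`. [cite: HatcherAT2002, §3.1 p. 200] -/
theorem δ_comp_toAbsolute (A : Set X) (i j : ℕ) (hij : i + 1 = j) :
    δ R M X A i j hij ≫ toAbsolute R M X A j = 0 :=
  (relShortComplex_shortExact R M A).δ_comp i j hij

end relSingularCohomology

namespace LerayHirsch

variable (R : Type u) [CommRing R] {ι : Type w} [Fintype ι] (d : ι → ℕ)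
variable {X' B' : Type u} [TopologicalSpace X'] [TopologicalSpace B']

/-! ### Exactness of the componentwise rows -/

section Rows

variable (B') (A : Set B')

omit [Fintype ι] in
/-- `δ ∘ res = 0` componentwise. [cite: HatcherAT2002, §3.1 p. 200] -/
theorem δSrc_resSrc (k : ℕ) (a : Src R d B' k) : δSrc R d B' A k (resSrc R d A k a) = 0 := by
  funext j
  rw [δSrc_apply]
  split_ifs with h
  · change (singularCohomology.map R R (subsetIncl A) (k - d j.1) ≫
      relSingularCohomology.δ R R B' A (k - d j.1) (k + 1 - d j.1) (by omega)) (a ⟨j.1, h⟩) = 0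
    rw [map_subsetIncl_comp_δ R R A]
    rfl
  · rfl

omit [Fintype ι] in
/-- `toAbsolute ∘ δ = 0` componentwise. [cite: HatcherAT2002, §3.1 p. 200] -/
theorem toAbsSrc_δSrc (k : ℕ) (a : Src R d (↥A) k) : toAbsSrc R d A (k + 1) (δSrc R d B' A k a) = 0 := by
  funext j
  rw [toAbsSrc_apply, δSrc_apply]
  split_ifs with h
  · change (relSingularCohomology.δ R R B' A (k - d j.1) (k + 1 - d j.1) (by omega) ≫
      relSingularCohomology.toAbsolute R R B' A (k + 1 - d j.1)) (a ⟨j.1, h⟩) = 0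
    rw [relSingularCohomology.δ_comp_toAbsolute]
    rfl
  · exact map_zero _

omit [Fintype ι] in
/-- `res ∘ toAbsolute = 0` componentwise. [cite: HatcherAT2002, §3.1 p. 200] -/
theorem resSrc_toAbsSrc (k : ℕ) (a : SrcRel R d B' A k) : resSrc R d A k (toAbsSrc R d A k a) = 0 := by
  funext j
  change (relSingularCohomology.toAbsolute R R B' A (k - d j.1) ≫ singularCohomology.map R R (subsetIncl A) (k - d j.1)) (a j) = 0
  rw [toAbsolute_comp_map_subsetIncl R R A]
  rfl

omit [Fintype ι] in
/-- Exactness at `Π Hᵏ⁺¹⁻ᵈʲ(B', A)`: `ker toAbsolute ⊆ im δ` (componentwise; the components with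
`d j = k + 1` by injectivity in degree `0`). [cite: HatcherAT2002, §3.1 p. 200] -/
theorem exists_δSrc_eq (k : ℕ) (x : SrcRel R d B' A (k + 1)) (hx : toAbsSrc R d A (k + 1) x = 0) :
    ∃ a : Src R d (↥A) k, δSrc R d B' A k a = x := by
  have hx' : ∀ j, relSingularCohomology.toAbsolute R R B' A (k + 1 - d j.1) (x j) = 0 := fun j ↦ by
    rw [← toAbsSrc_apply, hx]; rfl
  have hex : ∀ j : Idx d k, ∃ y : singularCohomology R R (↥A) (k - d j.1),
      relSingularCohomology.δ R R B' A (k - d j.1) (k + 1 - d j.1) (by omega) y = x ⟨j.1, by omega⟩ := fun j ↦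
    exists_of_moduleCat_exact (relSingularCohomology.exact_δ_toAbsolute (R := R) (M := R) (X := B') A
      (k - d j.1) (k + 1 - d j.1) (by omega)) _ (hx' ⟨j.1, by omega⟩)
  choose y hy using hex
  refine ⟨y, funext fun j ↦ ?_⟩
  rw [δSrc_apply]
  split_ifs with h
  · exact hy ⟨j.1, h⟩
  · exact ((relSingularCohomology.toAbsolute_injective_of_eq_zero (R := R) (M := R) A (by omega : k + 1 - d j.1 = 0))
      ((hx' j).trans (map_zero _).symm)).symm

omit [Fintype ι] in
/-- Exactness at `Π Hᵏ⁻ᵈʲ(B')`: `ker res ⊆ im toAbsolute`. [cite: HatcherAT2002, §3.1 p. 200] -/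
theorem exists_toAbsSrc_eq (k : ℕ) (x : Src R d B' k) (hx : resSrc R d A k x = 0) :
    ∃ a : SrcRel R d B' A k, toAbsSrc R d A k a = x := by
  have hex : ∀ j : Idx d k, ∃ y : relSingularCohomology R R B' A (k - d j.1),
      relSingularCohomology.toAbsolute R R B' A (k - d j.1) y = x j := fun j ↦
    exists_of_moduleCat_exact (relSingularCohomology.exact_toAbsolute_map (R := R) (M := R) (X := B') A (k - d j.1)) _
      (by rw [← srcMap_apply, hx]; rfl)
  choose y hy using hex
  exact ⟨y, funext fun j ↦ hy j⟩

omit [Fintype ι] in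
/-- Exactness at `Π Hᵏ⁻ᵈʲ(A)`: `ker δ ⊆ im res`. [cite: HatcherAT2002, §3.1 p. 200] -/
theorem exists_resSrc_eq (k : ℕ) (x : Src R d (↥A) k) (hx : δSrc R d B' A k x = 0) :
    ∃ a : Src R d B' k, resSrc R d A k a = x := by
  have hex : ∀ j : Idx d k, ∃ y : singularCohomology R R B' (k - d j.1),
      singularCohomology.map R R (subsetIncl A) (k - d j.1) y = x j := fun j ↦
    exists_of_moduleCat_exact (relSingularCohomology.exact_map_δ (R := R) (M := R) (X := B') A
      (k - d j.1) (k + 1 - d j.1) (by omega)) _ (by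
        have := congrFun hx ⟨j.1, by omega⟩
        rw [δSrc_apply, dif_pos j.2] at this
        exact this)
  choose y hy using hex
  exact ⟨y, funext fun j ↦ hy j⟩

omit [Fintype ι] in
/-- In degree `0` the componentwise `toAbsolute` is injective. [cite: HatcherAT2002, §3.1 p. 199] -/
theorem toAbsSrc_zero_injective : Injective (toAbsSrc R d A 0) := fun x y hxy ↦
  funext fun j ↦ relSingularCohomology.toAbsolute_injective_of_eq_zero (R := R) (M := R) A (Nat.zero_sub _)
    (by rw [← toAbsSrc_apply, ← toAbsSrc_apply, hxy])

end Rows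

/-! ### The pair step -/

variable (q : C(X', B')) (A : Set B') (c : (j : ι) → singularCohomology R R X' (d j))

/-- The restriction square: `θ_A(res a) = (θ a)|q⁻¹A`. [folklore] -/
theorem lhMap_resSrc (k : ℕ) (a : Src R d B' k) :
    lhMap R d (resMap q A) (resCls q A c) k (resSrc R d A k a) =
      singularCohomology.map R R (subsetIncl (q ⁻¹' A)) k (lhMap R d q c k a) :=
  (map_lhMap R d q (resMap q A) (subsetIncl (q ⁻¹' A)) (subsetIncl A) (comp_subsetIncl_preimage q A) c k a).symm

/-- **The pair step, relative from absolute**: if `θ` is bijective (in all degrees) for `E' → B'`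
and for `q⁻¹A → A`, then the relative comparison map of the pair `(E', q⁻¹A)` over `(B', A)` is
bijective. [cite: HusemollerFibreBundles1994, Ch. 17 §1 Thm. 1.1 (proof)] [cite: HatcherAT2002, §4.D Thm. 4D.1 (proof)] -/
theorem bijective_lhRel_of_abs (hX : ∀ k, Bijective (lhMap R d q c k))
    (hA : ∀ k, Bijective (lhMap R d (resMap q A) (resCls q A c) k)) (k : ℕ) :
    Bijective (lhRel R d q A c k) := by
  cases k with
  | zero =>
    exact LinearMap.bijective_of_five_lemma_zero₁₂
      (toAbsSrc R d A 0) (resSrc R d A 0)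
      (relSingularCohomology.toAbsolute R R X' (q ⁻¹' A) 0).hom (singularCohomology.map R R (subsetIncl (q ⁻¹' A)) 0).hom
      (lhRel R d q A c 0) (lhMap R d q c 0) (lhMap R d (resMap q A) (resCls q A c) 0)
      (fun x ↦ (toAbsolute_lhRel R d q A c 0 x).symm) (fun x ↦ lhMap_resSrc R d q A c 0 x)
      (toAbsSrc_zero_injective R d B' A) (exists_toAbsSrc_eq R d B' A 0)
      (toAbsolute_zero_injective R R (q ⁻¹' A))
      (fun x ↦ by
        change (relSingularCohomology.toAbsolute R R X' (q ⁻¹' A) 0 ≫ singularCohomology.map R R (subsetIncl (q ⁻¹' A)) 0) x = 0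
        rw [toAbsolute_comp_map_subsetIncl R R]; rfl)
      (hX 0) (hA 0).1
  | succ k =>
    exact LinearMap.bijective_of_five_lemma
      (resSrc R d A k) (δSrc R d B' A k) (toAbsSrc R d A (k + 1)) (resSrc R d A (k + 1))
      (singularCohomology.map R R (subsetIncl (q ⁻¹' A)) k).hom
      (relSingularCohomology.δ R R X' (q ⁻¹' A) k (k + 1) rfl).hom
      (relSingularCohomology.toAbsolute R R X' (q ⁻¹' A) (k + 1)).hom
      (singularCohomology.map R R (subsetIncl (q ⁻¹' A)) (k + 1)).hom
      (lhMap R d q c k) (lhMap R d (resMap q A) (resCls q A c) k) (lhRel R d q A c (k + 1)) (lhMap R d q c (k + 1))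
      (lhMap R d (resMap q A) (resCls q A c) (k + 1))
      (fun x ↦ lhMap_resSrc R d q A c k x) (fun x ↦ (δ_lhMap R d q A c k x).symm)
      (fun x ↦ (toAbsolute_lhRel R d q A c (k + 1) x).symm) (fun x ↦ lhMap_resSrc R d q A c (k + 1) x)
      (δSrc_resSrc R d B' A k) (exists_δSrc_eq R d B' A k) (exists_toAbsSrc_eq R d B' A (k + 1))
      (fun x hx ↦ exists_of_moduleCat_exact
        (relSingularCohomology.exact_map_δ (R := R) (M := R) (X := X') (q ⁻¹' A) k (k + 1) rfl) x hx)
      (fun x hx ↦ exists_of_moduleCat_exact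
        (relSingularCohomology.exact_δ_toAbsolute (R := R) (M := R) (X := X') (q ⁻¹' A) k (k + 1) rfl) x hx)
      (fun x ↦ by
        change (relSingularCohomology.toAbsolute R R X' (q ⁻¹' A) (k + 1) ≫
          singularCohomology.map R R (subsetIncl (q ⁻¹' A)) (k + 1)) x = 0
        rw [toAbsolute_comp_map_subsetIncl R R]; rfl)
      (hX k).2 (hA k) (hX (k + 1)) (hA (k + 1)).1

/-- **The pair step, absolute from relative**: if the relative comparison map of `(E', q⁻¹A)` over
`(B', A)` and the comparison map of `q⁻¹A → A` are bijective (all degrees), then so is the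
comparison map of `E' → B'`. [cite: HusemollerFibreBundles1994, Ch. 17 §1 Thm. 1.1 (proof)] [cite: HatcherAT2002, §4.D Thm. 4D.1 (proof)] -/
theorem bijective_lhMap_of_rel (hRel : ∀ k, Bijective (lhRel R d q A c k))
    (hA : ∀ k, Bijective (lhMap R d (resMap q A) (resCls q A c) k)) (k : ℕ) :
    Bijective (lhMap R d q c k) := by
  cases k with
  | zero =>
    exact LinearMap.bijective_of_five_lemma_zero₁
      (toAbsSrc R d A 0) (resSrc R d A 0) (δSrc R d B' A 0)
      (relSingularCohomology.toAbsolute R R X' (q ⁻¹' A) 0).hom (singularCohomology.map R R (subsetIncl (q ⁻¹' A)) 0).hom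
      (relSingularCohomology.δ R R X' (q ⁻¹' A) 0 1 rfl).hom
      (lhRel R d q A c 0) (lhMap R d q c 0) (lhMap R d (resMap q A) (resCls q A c) 0) (lhRel R d q A c 1)
      (fun x ↦ (toAbsolute_lhRel R d q A c 0 x).symm) (fun x ↦ lhMap_resSrc R d q A c 0 x)
      (fun x ↦ (δ_lhMap R d q A c 0 x).symm)
      (exists_toAbsSrc_eq R d B' A 0) (exists_resSrc_eq R d B' A 0)
      (toAbsolute_zero_injective R R (q ⁻¹' A))
      (fun x hx ↦ exists_of_moduleCat_exact
        (relSingularCohomology.exact_toAbsolute_map (R := R) (M := R) (X := X') (q ⁻¹' A) 0) x hx)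
      (fun x ↦ by
        change (singularCohomology.map R R (subsetIncl (q ⁻¹' A)) 0 ≫ relSingularCohomology.δ R R X' (q ⁻¹' A) 0 1 rfl) x = 0
        rw [map_subsetIncl_comp_δ R R]; rfl)
      (hRel 0) (hA 0) (hRel 1).1
  | succ k =>
    exact LinearMap.bijective_of_five_lemma
      (δSrc R d B' A k) (toAbsSrc R d A (k + 1)) (resSrc R d A (k + 1)) (δSrc R d B' A (k + 1))
      (relSingularCohomology.δ R R X' (q ⁻¹' A) k (k + 1) rfl).hom
      (relSingularCohomology.toAbsolute R R X' (q ⁻¹' A) (k + 1)).hom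
      (singularCohomology.map R R (subsetIncl (q ⁻¹' A)) (k + 1)).hom
      (relSingularCohomology.δ R R X' (q ⁻¹' A) (k + 1) (k + 2) rfl).hom
      (lhMap R d (resMap q A) (resCls q A c) k) (lhRel R d q A c (k + 1)) (lhMap R d q c (k + 1))
      (lhMap R d (resMap q A) (resCls q A c) (k + 1)) (lhRel R d q A c (k + 2))
      (fun x ↦ (δ_lhMap R d q A c k x).symm) (fun x ↦ (toAbsolute_lhRel R d q A c (k + 1) x).symm)
      (fun x ↦ lhMap_resSrc R d q A c (k + 1) x) (fun x ↦ (δ_lhMap R d q A c (k + 1) x).symm)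
      (toAbsSrc_δSrc R d B' A k) (exists_toAbsSrc_eq R d B' A (k + 1)) (exists_resSrc_eq R d B' A (k + 1))
      (fun x hx ↦ exists_of_moduleCat_exact
        (relSingularCohomology.exact_δ_toAbsolute (R := R) (M := R) (X := X') (q ⁻¹' A) k (k + 1) rfl) x hx)
      (fun x hx ↦ exists_of_moduleCat_exact
        (relSingularCohomology.exact_toAbsolute_map (R := R) (M := R) (X := X') (q ⁻¹' A) (k + 1)) x hx)
      (fun x ↦ by
        change (singularCohomology.map R R (subsetIncl (q ⁻¹' A)) (k + 1) ≫
          relSingularCohomology.δ R R X' (q ⁻¹' A) (k + 1) (k + 2) rfl) x = 0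
        rw [map_subsetIncl_comp_δ R R]; rfl)
      (hA k).2 (hRel (k + 1)) (hA (k + 1)) (hRel (k + 2)).1

end LerayHirsch

end Literature.AlgebraicTopology.SingularHomology
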